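import Summits.BirchSwinnertonDyer.BirchSwinnertonDyer.Theorems.ResidualThetaTransportAtTwoSignedMuSeedAtTwoPlusTiltHomGrading
import Summits.BirchSwinnertonDyer.BirchSwinnertonDyer.Theorems.ResidualThetaTransportAtTwoSignedMuSeedAtTwoPlusJetLevelOneWallSharp
import HarnessLib

/-!
# The walls ON THE ENGINE'S OWN OBJECTS: level step `δ_m = F̄_U(([w_m]_f‾ t)^{N}, t) − t` over `𝔽₄ = ℤ₄/(−2)`, `c_m = 0`, levels one and two
# (seed lines `norm-field-tilt` / `jet-character-sums`; crux `SignedMuSeedAtTwoPlus` stmt-BirchSwinnertonDyer-21438; Kμ⁺ stmt-BirchSwinnertonDyer-20689)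

Cell `bsd-wall`, width seat `bsd-wall-rtt-p4-w2` g13 (`--supports`, closes nothing).  THEOREMS ONLY; the lines are NOT registered (W-79); BSD is not
proved by this.

Capstone of this seat's wall files: everything is instantiated on the objects of the tilt engine `Tilt.oddDigit_of_nonDeg_tiltCurve` (p676492) —
base `𝒪 = ℤ₄ = LubinTate.unitBall ℚ_[2]⟮ζ₃⟯`, residue ring `k = 𝒪/(−2)` (`CharP k 2`), tilt curve `U = ⟨0,0,1,0,0⟩`, Lubin–Tate series `f_U`,
endomorphisms `[w]_f = LubinTate.hom …`, reduced `z_w := [w]_f‾ ∈ k⟦t⟧`: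
* `constantCoeff_homBar`, **`coeff_two_homBar_eq_zero`** (`[t²]z_w = 0`, from `…TiltHomGrading`, given a primitive cube root `ρ ∈ 𝒪`, e.g. `ζ₃`);
* generic over any ring of characteristic `2` with `z(0) = 0`, `[t²]z = 0` (the engine's case by the two lemmas above):
  **`delta_shape_of_coeff_two_eq_zero`** — `F̄_U(z^{2^n}, t) − t = C(z₁^{2^n})·t^{2^n} + C 0·t^{2·2^n} + t^{2·2^n+2}·ε` (`n ≥ 1`): the wall constant `c` is `0`;
  **`levelOne_wall_of_coeff_two_eq_zero`** — `S₀' = S₀²`, `[t⁰]S₀ = [t²]S₀ = 0`, `δ₀ = F̄(z⁴,t) − t` ⟹ `t¹⁴ ∣ S₁ − (z₁⁴T₄² + z₁⁸T₆)t¹²`, `[t¹⁴] = [t¹⁵] = 0`;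
  **`levelTwo_wall_of_coeff_two_eq_zero`** — `S₁' = S₁²`, `ord S₁ ≥ 14`, `U₁₄ = 0`, `δ₁ = F̄(z^{16}, t) − t`, `ū = z₁^{16}`:
  `[t⁴⁴]S₂ = 0`, `[t⁴⁸] = ūU₁₆² + ū²U₁₈`, `[t⁵²] = ūU₁₈² + ū²U₂₂`, `[t⁵⁶] = ūU₂₀² + ū²U₂₆`, `[t⁵⁹] = 0`, `[t⁶⁰] = ūU₂₂² + ū²U₃₀`, `[t⁶¹] = 0`.
[folklore]
-/

set_option autoImplicit false
-- the Theorems namespace of this sub repeats the summit name by design (D-0017 nested layout)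
set_option linter.dupNamespace false

noncomputable section

open scoped Classical IntermediateField
open PowerSeries WeierstrassCurve
open Literature.NumberTheory.EllipticCurves
open Literature.NumberTheory.GaloisRepresentations
open Summit.BirchSwinnertonDyer.BirchSwinnertonDyer.Theorems.RelativeLubinTate.ZFour
open Summit.BirchSwinnertonDyer.BirchSwinnertonDyer.Theorems.SignedMuAtTwo.JetCharacterSums

namespace Summit.BirchSwinnertonDyer.BirchSwinnertonDyer.Theorems.SignedMuAtTwo.Tilt

variable {ζ : PadicAlgCl 2} (hζ : ζ ^ 2 + ζ + 1 = 0)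

/-- `z_w = [w]_f‾` has no constant term. [folklore] -/
theorem constantCoeff_homBar (w : LubinTate.unitBall (↥ℚ_[2]⟮ζ⟯)) :
    constantCoeff ((LubinTate.hom (isLTRing_unitBall_adjoin_zeta hζ)
      (isLTSeries_tiltCurve (LubinTate.unitBall (↥ℚ_[2]⟮ζ⟯))) (isLTSeries_tiltCurve (LubinTate.unitBall (↥ℚ_[2]⟮ζ⟯))) w).map
      (Ideal.Quotient.mk (Ideal.span {-((2 : ℕ) : LubinTate.unitBall (↥ℚ_[2]⟮ζ⟯))}))) = 0 := by
  rw [← coeff_zero_eq_constantCoeff_apply, coeff_map, coeff_zero_eq_constantCoeff_apply, LubinTate.constantCoeff_hom, map_zero]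

/-- **`[t²]z_w = 0`**: the reduced endomorphism has no quadratic term (ℤ/3-grading; `ρ ∈ 𝒪` any primitive cube root of unity, e.g. `ζ₃`). [folklore] -/
theorem coeff_two_homBar_eq_zero {ρ : LubinTate.unitBall (↥ℚ_[2]⟮ζ⟯)} (hρ : ρ ^ 2 + ρ + 1 = 0) (w : LubinTate.unitBall (↥ℚ_[2]⟮ζ⟯)) :
    coeff 2 ((LubinTate.hom (isLTRing_unitBall_adjoin_zeta hζ)
      (isLTSeries_tiltCurve (LubinTate.unitBall (↥ℚ_[2]⟮ζ⟯))) (isLTSeries_tiltCurve (LubinTate.unitBall (↥ℚ_[2]⟮ζ⟯))) w).map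
      (Ideal.Quotient.mk (Ideal.span {-((2 : ℕ) : LubinTate.unitBall (↥ℚ_[2]⟮ζ⟯))}))) = 0 := by
  rw [coeff_map, coeff_hom_tiltCurve_zFour_eq_zero hζ hρ w (by norm_num), map_zero]

section Levels

/-! ### Generic form (any commutative ring of characteristic `2`; instantiate with `z = z_w` via `constantCoeff_homBar`,
`coeff_two_homBar_eq_zero` — stated abstractly because rewriting under the `ℤ₄`-quotient types is expensive for the elaborator) -/

variable {k : Type*} [CommRing k] [CharP k 2] {z S δ : PowerSeries k} (hz0 : constantCoeff z = 0) (hz2 : coeff 2 z = 0)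

include hz0 hz2 in
/-- **The level step has the wall shape with `c = 0`** when `[t²]z = 0` (the engine's case): for `n ≥ 1`,
`F̄_U(z^{2^n}, t) − t = C(z₁^{2^n})·t^{2^n} + C 0·t^{2·2^n} + t^{2·2^n+2}·ε`. [folklore] -/
theorem delta_shape_of_coeff_two_eq_zero {n : ℕ} (hn : 1 ≤ n) :
    ∃ ε : PowerSeries k, MvPowerSeries.subst ![z ^ 2 ^ n, X] ((⟨0, 0, 1, 0, 0⟩ : WeierstrassCurve k).formalGroupLaw) - X =
      C (coeff 1 z ^ 2 ^ n) * X ^ 2 ^ n + C 0 * X ^ (2 * 2 ^ n) + X ^ (2 * 2 ^ n + 2) * ε := by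
  obtain ⟨ε, hε⟩ := exists_levelStep_delta_shape₃ hz0 hn
  refine ⟨ε, hε.trans ?_⟩
  rw [hz2, zero_pow (pow_ne_zero n two_ne_zero)]

include hz0 hz2 in
/-- **Level one with the tree's translation and `[t²]z = 0`**: `S₀' = S₀²`, `[t⁰]S₀ = [t²]S₀ = 0`, `δ₀ = F̄(z⁴, t) − t` ⟹
`t¹⁴ ∣ S₁ − (z₁⁴T₄² + z₁⁸T₆)t¹²` and `[t¹⁴]S₁ = [t¹⁵]S₁ = 0` (`S₁ = S₀ + S₀(t + δ₀)`). [folklore] -/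
theorem levelOne_wall_of_coeff_two_eq_zero (hR : d⁄dX k S = S * S) (h0 : coeff 0 S = 0) (h2 : coeff 2 S = 0)
    (hδ : δ = MvPowerSeries.subst ![z ^ 4, X] ((⟨0, 0, 1, 0, 0⟩ : WeierstrassCurve k).formalGroupLaw) - X) :
    ((X : PowerSeries k) ^ 14 ∣ S + S.subst (X + δ) - C (coeff 1 z ^ 4 * coeff 4 S ^ 2 + (coeff 1 z ^ 4) ^ 2 * coeff 6 S) * X ^ 12) ∧
      coeff 14 (S + S.subst (X + δ)) = 0 ∧ coeff 15 (S + S.subst (X + δ)) = 0 := by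
  obtain ⟨ε, hε⟩ := delta_shape_of_coeff_two_eq_zero hz0 hz2 (n := 2) (by norm_num)
  have hδ' : δ = C (coeff 1 z ^ 4) * X ^ 4 + C 0 * X ^ (2 * 4) + X ^ (2 * 4 + 2) * ε := by rw [hδ]; exact hε
  refine ⟨?_, levelOne_wall_sharp hR h0 h2 hδ'⟩
  have hδ8 : (X : PowerSeries k) ^ 8 ∣ δ - C (coeff 1 z ^ 4) * X ^ 4 := ⟨C 0 + X ^ 2 * ε, by rw [hδ']; ring⟩
  exact X_pow_fourteen_dvd_levelOne_sub hR h0 h2 hδ8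

include hz0 hz2 in
/-- **Level two with the tree's translation and `[t²]z = 0`**: `S₁' = S₁²`, `ord S₁ ≥ 14`, `U₁₄ = 0`, `δ₁ = F̄(z^{16}, t) − t`, `ū = z₁^{16}`:
`[t⁴⁴]S₂ = 0`, `[t⁴⁸] = ūU₁₆² + ū²U₁₈`, `[t⁵²] = ūU₁₈² + ū²U₂₂`, `[t⁵⁶] = ūU₂₀² + ū²U₂₆`, `[t⁵⁹] = 0`, `[t⁶⁰] = ūU₂₂² + ū²U₃₀`, `[t⁶¹] = 0`
— `NonDeg(2)` (`v(S₂) < 62`) is read off four polynomials in `U₁₆, …, U₃₀` and `ū`. [folklore] -/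
theorem levelTwo_wall_of_coeff_two_eq_zero (hR : d⁄dX k S = S * S) (hv : ((14 : ℕ) : ℕ∞) ≤ S.order) (h14 : coeff 14 S = 0)
    (hδ : δ = MvPowerSeries.subst ![z ^ 16, X] ((⟨0, 0, 1, 0, 0⟩ : WeierstrassCurve k).formalGroupLaw) - X) :
    coeff 44 (S + S.subst (X + δ)) = 0 ∧
      coeff 48 (S + S.subst (X + δ)) = coeff 1 z ^ 16 * coeff 16 S ^ 2 + (coeff 1 z ^ 16) ^ 2 * coeff 18 S ∧
      coeff 52 (S + S.subst (X + δ)) = coeff 1 z ^ 16 * coeff 18 S ^ 2 + (coeff 1 z ^ 16) ^ 2 * coeff 22 S ∧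
      coeff 56 (S + S.subst (X + δ)) = coeff 1 z ^ 16 * coeff 20 S ^ 2 + (coeff 1 z ^ 16) ^ 2 * coeff 26 S ∧
      coeff 59 (S + S.subst (X + δ)) = 0 ∧
      coeff 60 (S + S.subst (X + δ)) = coeff 1 z ^ 16 * coeff 22 S ^ 2 + (coeff 1 z ^ 16) ^ 2 * coeff 30 S ∧
      coeff 61 (S + S.subst (X + δ)) = 0 := by
  obtain ⟨ε, hε⟩ := delta_shape_of_coeff_two_eq_zero hz0 hz2 (n := 4) (by norm_num)
  have hδ3 : δ = C (coeff 1 z ^ 16) * X ^ 16 + C 0 * X ^ (2 * 16) + X ^ (2 * 16 + 2) * ε := by rw [hδ]; exact hε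
  have hδ2 : δ = C (coeff 1 z ^ 16) * X ^ 16 + X ^ (2 * 16) * (C 0 + X ^ 2 * ε) := by rw [hδ3]; ring
  have hW := levelTwo_wall hR hv hδ2
  have hC := levelTwo_wall_complete hR hv hδ3
  have hS := levelTwo_nonDeg_support hR hv h14 hδ3
  exact ⟨hS.1, hW.2.1, hW.2.2.1, hW.2.2.2, hC.1, hS.2, hC.2.2⟩

end Levels

end Summit.BirchSwinnertonDyer.BirchSwinnertonDyer.Theorems.SignedMuAtTwo.Tilt

end
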